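import Mathlib
import Literature.NumberTheory.LFunctions.Zhang2022.TypedSection11A
import Literature.NumberTheory.LFunctions.Zhang2022.Section11GaussTails
import HarnessLib

/-!
# Zhang (2022) §11, p. 63: the tails of `J̃₁(s,ψ)` contribute `≪ ε` — node `Z22:§11.u005b` DISCHARGED

Topic `Literature/NumberTheory/LFunctions/Zhang2022` (Landau–Siegel audit tree; verdict-neutral).
Y. Zhang, *Discrete mean estimates and the Landau–Siegel zero*, arXiv:2211.02515v1 (2022)
[Zhang2022LandauSiegel] — **an unrefereed manuscript under adjudication** (campaign D-0069: every
displayed claim typed, then discharged or gap-ledgered; typed ≠ discharged). §11 p. 63, tex L3216: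

> By (5) and (5), for `σ = 1/2`, the terms with `n ≤ P^{0.5}η₋` or `n ≥ P^{0.504}η₊` in `J̃₁(s,ψ)`
> contribute `≪ ε`.

(`ε = exp{−c𝓛¹⁰}`, §4 p. 20; `η_± = exp{±𝓛⁻¹⁰}`; the two references "(5)" are malformed in the
source — gap candidate G·11a.) Typed as `Typed.Sec11A.TailsClaimP` (`TypedSection11A.lean`, over the
correctly parenthesised printed weight `g̃₁(y) = −500∫_{0.5}^{0.502} g(P^z/y)dz + 500∫_{0.502}^{0.504}
g(P^z/y)dz`; the v1 `TailsClaim` sits on the banked `Skeleton.gtilde1`, see that file's TYPING NOTE).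
**This file PROVES it** — `tails_bound` (the display with the weight written out, `c = 1/2`, `C = 2`,
`D ≥ ⌈e⁵⌉`), `tailsClaimP_holds`, and the bridge `tailsClaim_of_gtilde1_eq` to the v1 typing
(instantiated by `rfl` once the skeleton's `gtilde1` is re-parenthesised in place) — from the
manuscript's own (4.2)–(4.3), i.e. the tree theorems `GaussWeight.abs_gWeight_sub_one_le` /
`GaussWeight.gWeight_le` for the weight `g` of (4.1), and nothing else (Assumption (A), carried by
the typed statement, is unused): the malformed references resolve to (4.2)/(4.3); NOT a gap.
Head (`n ≤ P^{0.5}η₋`): `log(P^z/n) ≥ 𝓛⁻¹⁰` for `z ≥ 0.5`, so `g = 1 + O(e^{−𝓛¹⁰})` and the two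
integrals cancel, `|g̃₁(n)| ≤ e^{−𝓛¹⁰}`; tail (`n ≥ P^{0.504}η₊`): `log(P^z/n) ≤ −u`, `u ≥ 𝓛⁻¹⁰`, so
`0 < g ≤ ½e^{−𝓛²⁰u}`, `|g̃₁(n)| ≤ e^{−𝓛²⁰u}`; both regimes sit under the summable majorant
`e^{−𝓛¹⁰/2}n⁻²` (sum `≤ (π²/6)e^{−𝓛¹⁰/2}`). The pointwise (4.2)/(4.3) lemmas and the large-`𝓛`
bookkeeping are the shared ones of `Section11GaussTails.lean` (namespace `GaussTails`).

WHAT THIS IS NOT: any statement about the manuscript's Theorems 1–2 or about Landau–Siegel zeros;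
it discharges one proof-internal display of §11 from (4.2)/(4.3), kernel-checked, 0 new facts.

## References

* Y. Zhang, arXiv:2211.02515v1 (2022), §11 p. 63 (tex L3202–L3216); §4 (4.1)–(4.3).
  [cite: Zhang2022LandauSiegel, §11 p. 63; §4 (4.2)–(4.3)]
-/

noncomputable section

open Real Set MeasureTheory


namespace Literature.NumberTheory.LFunctions.Zhang2022.Typed.Sec11A

open Skeleton GaussTails

variable {D : ℕ}

/-! ## `g̃₁` at the head and at the tail -/

/-- **Head**: for `1 ≤ y ≤ P^{0.5}η₋`, `|g̃₁(y)| ≤ e^{−𝓛¹⁰}` — both integrals of `g̃₁` are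
`0.002 + O(0.001e^{−𝓛¹⁰})` by (4.2), and the weights `∓500` cancel.
[cite: Zhang2022LandauSiegel, §11 p. 63; §4 (4.2)] -/
theorem abs_weight_le_head (hL : 0 < ell D) {y : ℝ} (hy1 : 1 ≤ y)
    (hy : y ≤ bigP D ^ (0.5 : ℝ) * etaPM D (-1)) :
    |-500 * (∫ z in (0.5 : ℝ)..0.502, gW D (bigP D ^ z / y)) +
        500 * (∫ z in (0.502 : ℝ)..0.504, gW D (bigP D ^ z / y))| ≤ Real.exp (-ell D ^ 10) := by
  have hy0 : 0 < y := by linarith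
  have hlogy : Real.log y ≤ 0.5 * ell D ^ 9 - (ell D ^ 10)⁻¹ := by
    have h1 := Real.log_le_log hy0 hy
    rw [log_rpow_mul_etaPM] at h1
    linarith
  have h1 := abs_integral_gW_sub_len_le hL hy0 (a := 0.5) (b := 0.502) (by norm_num) (by linarith)
  have h2 := abs_integral_gW_sub_len_le hL hy0 (a := 0.502) (b := 0.504) (by norm_num)
    (by nlinarith [pow_pos hL 9])
  rw [abs_le] at h1 h2 ⊢
  obtain ⟨h1l, h1u⟩ := h1
  obtain ⟨h2l, h2u⟩ := h2
  set I₁ : ℝ := ∫ z in (0.5 : ℝ)..0.502, gW D (bigP D ^ z / y) with hI₁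
  set I₂ : ℝ := ∫ z in (0.502 : ℝ)..0.504, gW D (bigP D ^ z / y) with hI₂
  set ε : ℝ := Real.exp (-ell D ^ 10) with hε
  norm_num at h1l h1u h2l h2u ⊢
  constructor <;> linarith

/-- **Tail**: for `y ≥ P^{0.504}η₊`, `|g̃₁(y)| ≤ e^{−𝓛²⁰(log y − 0.504𝓛⁹)}` — on both ranges of
integration `0 < g(P^z/y) ≤ ½e^{−𝓛²⁰u}` by (4.3). [cite: Zhang2022LandauSiegel, §11 p. 63; §4 (4.3)] -/
theorem abs_weight_le_tail (hL : 0 < ell D) {y : ℝ}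
    (hy : bigP D ^ (0.504 : ℝ) * etaPM D 1 ≤ y) :
    |-500 * (∫ z in (0.5 : ℝ)..0.502, gW D (bigP D ^ z / y)) +
        500 * (∫ z in (0.502 : ℝ)..0.504, gW D (bigP D ^ z / y))| ≤
      Real.exp (-(ell D ^ 20 * (Real.log y - 0.504 * ell D ^ 9))) := by
  have hy0 : 0 < y := lt_of_lt_of_le (rpow_mul_etaPM_pos D _ _) hy
  have hlogy : 0.504 * ell D ^ 9 + (ell D ^ 10)⁻¹ ≤ Real.log y := by
    have h1 := Real.log_le_log (rpow_mul_etaPM_pos D _ _) hy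
    rw [log_rpow_mul_etaPM] at h1
    linarith
  set u : ℝ := Real.log y - 0.504 * ell D ^ 9 with hu_def
  have hu : (ell D ^ 10)⁻¹ ≤ u := by rw [hu_def]; linarith
  have h1 := abs_integral_gW_le hL hy0 (a := 0.5) (b := 0.502) (by norm_num) hu
    (by rw [hu_def]; nlinarith [pow_pos hL 9])
  have h2 := abs_integral_gW_le hL hy0 (a := 0.502) (b := 0.504) (by norm_num) hu
    (by rw [hu_def]; linarith)
  rw [abs_le] at h1 h2 ⊢
  obtain ⟨h1l, h1u⟩ := h1
  obtain ⟨h2l, h2u⟩ := h2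
  set I₁ : ℝ := ∫ z in (0.5 : ℝ)..0.502, gW D (bigP D ^ z / y) with hI₁
  set I₂ : ℝ := ∫ z in (0.502 : ℝ)..0.504, gW D (bigP D ^ z / y) with hI₂
  set ε : ℝ := Real.exp (-(ell D ^ 20 * u)) with hε
  norm_num at h1l h1u h2l h2u ⊢
  constructor <;> linarith

/-! ## The node -/

/-- **`Z22:§11.u005b`, explicit form** (p. 63, tex L3216): with the printed weight
`g̃₁(n) = −500∫_{0.5}^{0.502} g(P^z/n)dz + 500∫_{0.502}^{0.504} g(P^z/n)dz` written out, the terms of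
`J̃₁(s,ψ) = Σ_n ψχ(n)g̃₁(n)n^{−s}` with `n ≤ P^{0.5}η₋` or `n ≥ P^{0.504}η₊` have a sum of norm
`≤ 2e^{−𝓛¹⁰/2}` for `σ = 1/2` and `D ≥ ⌈e⁵⌉` (so `c = 1/2`, `C = 2` in "`≪ ε = exp{−c𝓛¹⁰}`"); from
(4.2)–(4.3) only. Stated over the displayed expression itself, so that it serves every typed name of
the node (`TailsClaimP` below; the v1 `TailsClaim` via `tailsClaim_of_gtilde1_eq`).
[Z22 p.63, tex L3216] [cite: Zhang2022LandauSiegel, §11 p. 63] -/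
theorem tails_bound :
    ∃ c : ℝ, 0 < c ∧ ∃ C : ℝ, ForAllLarge fun D _ χ => AssumptionA D χ → ∀ x : Chr D, ∀ s : ℂ,
      s.re = 1 / 2 →
        ‖∑' n : ℕ, (if (n : ℝ) ≤ bigP D ^ (0.5 : ℝ) * etaPM D (-1) ∨
              bigP D ^ (0.504 : ℝ) * etaPM D 1 ≤ (n : ℝ)
            then pc χ x n *
              ((-500 * (∫ z in (0.5 : ℝ)..0.502, gW D (bigP D ^ z / n)) +
                  500 * (∫ z in (0.502 : ℝ)..0.504, gW D (bigP D ^ z / n)) : ℝ) : ℂ) *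
                (n : ℂ) ^ (-s) else 0)‖
          ≤ C * Real.exp (-c * ell D ^ 10) := by
  refine ⟨1 / 2, by norm_num, 2, ⌈Real.exp 5⌉₊, fun D _ χ hD _ _ _ x s hs => ?_⟩
  have hL5 : 5 ≤ ell D := five_le_ell hD
  have hL : 0 < ell D := by linarith
  set L : ℝ := ell D with hLdef
  have hMsum : HasSum (fun n : ℕ => Real.exp (-(L ^ 10 / 2)) * (1 / (n : ℝ) ^ 2))
      (Real.exp (-(L ^ 10 / 2)) * (π ^ 2 / 6)) := hasSum_zeta_two.mul_left _
  refine (norm_tsum_le_of_hasSum hMsum fun n => ?_).trans (zeta_two_mul_exp_le L)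
  split_ifs with hcond
  · rcases Nat.eq_zero_or_pos n with rfl | hn
    · have hs0 : -s ≠ 0 := by
        intro h
        have := congrArg Complex.re h
        rw [Complex.neg_re, hs] at this
        norm_num at this
      simp [Complex.zero_cpow hs0]
    · have hn1 : (1 : ℝ) ≤ n := by exact_mod_cast hn
      have hn0 : (0 : ℝ) < n := by positivity
      have hcpow : ‖(n : ℂ) ^ (-s)‖ ≤ 1 := by
        rw [Complex.norm_natCast_cpow_of_pos hn, Complex.neg_re, hs]
        exact Real.rpow_le_one_of_one_le_of_nonpos hn1 (by norm_num)
      have hg : |-500 * (∫ z in (0.5 : ℝ)..0.502, gW D (bigP D ^ z / n)) +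
            500 * (∫ z in (0.502 : ℝ)..0.504, gW D (bigP D ^ z / n))| ≤
            Real.exp (-(L ^ 10 / 2)) * (1 / ((n : ℝ)) ^ 2) := by
        rw [mul_one_div, le_div_iff₀ (by positivity), natCast_sq_eq_exp hn]
        have h9 : (0.504 : ℝ) * L ^ 9 ≤ L ^ 9 := by nlinarith [pow_pos hL 9]
        rcases hcond with hhead | htail
        · have h := abs_weight_le_head hL hn1 hhead
          have hlog : Real.log n ≤ 0.5 * L ^ 9 := by
            have h1 := Real.log_le_log hn0 hhead
            rw [log_rpow_mul_etaPM] at h1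
            nlinarith [inv_pos.mpr (pow_pos hL 10)]
          calc |-500 * (∫ z in (0.5 : ℝ)..0.502, gW D (bigP D ^ z / n)) +
                  500 * (∫ z in (0.502 : ℝ)..0.504, gW D (bigP D ^ z / n))| *
                Real.exp (2 * Real.log n)
              ≤ Real.exp (-L ^ 10) * Real.exp (2 * Real.log n) := by gcongr
            _ = Real.exp (-L ^ 10 + 2 * Real.log n) := (Real.exp_add _ _).symm
            _ ≤ Real.exp (-(L ^ 10 / 2)) :=
                Real.exp_le_exp.mpr (head_exponent_le hL5 (by nlinarith [pow_pos hL 9]) hlog)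
        · have h := abs_weight_le_tail hL htail
          have hlog : 0.504 * L ^ 9 + (L ^ 10)⁻¹ ≤ Real.log n := by
            have h1 := Real.log_le_log (rpow_mul_etaPM_pos D _ _) htail
            rw [log_rpow_mul_etaPM] at h1
            linarith
          calc |-500 * (∫ z in (0.5 : ℝ)..0.502, gW D (bigP D ^ z / n)) +
                  500 * (∫ z in (0.502 : ℝ)..0.504, gW D (bigP D ^ z / n))| *
                Real.exp (2 * Real.log n)
              ≤ Real.exp (-(L ^ 20 * (Real.log n - 0.504 * L ^ 9))) *
                  Real.exp (2 * Real.log n) := by gcongr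
            _ = Real.exp (-(L ^ 20 * (Real.log n - 0.504 * L ^ 9)) + 2 * Real.log n) :=
                (Real.exp_add _ _).symm
            _ ≤ Real.exp (-(L ^ 10 / 2)) := Real.exp_le_exp.mpr (tail_exponent_le hL5 h9 hlog)
      calc ‖pc χ x n *
            ((-500 * (∫ z in (0.5 : ℝ)..0.502, gW D (bigP D ^ z / n)) +
                500 * (∫ z in (0.502 : ℝ)..0.504, gW D (bigP D ^ z / n)) : ℝ) : ℂ) *
            (n : ℂ) ^ (-s)‖
          = ‖pc χ x n‖ *
              |-500 * (∫ z in (0.5 : ℝ)..0.502, gW D (bigP D ^ z / n)) +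
                500 * (∫ z in (0.502 : ℝ)..0.504, gW D (bigP D ^ z / n))| *
              ‖(n : ℂ) ^ (-s)‖ := by
            rw [norm_mul, norm_mul, Complex.norm_real, Real.norm_eq_abs]
        _ ≤ 1 * (Real.exp (-(L ^ 10 / 2)) * (1 / ((n : ℝ)) ^ 2)) * 1 := by
            gcongr
            exact norm_pc_le_one χ x n
        _ = Real.exp (-(L ^ 10 / 2)) * (1 / ((n : ℝ)) ^ 2) := by ring
  · simp only [norm_zero]
    positivity

/-- **`Z22:§11.u005b` holds as typed** (`Typed.Sec11A.TailsClaimP`, over the correctly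
parenthesised `g̃₁ = Typed.Sec11A.gTilde1`): the terms of `J̃₁(s,ψ)` with `n ≤ P^{0.5}η₋` or
`n ≥ P^{0.504}η₊` contribute `≪ ε` for `σ = 1/2` — `tails_bound` read through the definition of
`gTilde1`. Gap candidate G·11a ("By (5) and (5)") is NOT a gap: (4.2)/(4.3) suffice.
[Z22 p.63, tex L3216] [cite: Zhang2022LandauSiegel, §11 p. 63] -/
theorem tailsClaimP_holds : TailsClaimP := tails_bound

/-- **Bridge to the v1 typing** (`Typed.Sec11A.TailsClaim`, over the banked `Skeleton.gtilde1`): it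
follows verbatim from `tails_bound` as soon as `Skeleton.gtilde1` unfolds to the printed
`−500∫_{0.5}^{0.502} g + 500∫_{0.502}^{0.504} g` — by `rfl` once the skeleton's in-place
re-parenthesisation (STATUS 2026-08-25T23:49Z, SKEL-RULING (A)) has landed.
[Z22 p.63, tex L3216] [cite: Zhang2022LandauSiegel, §11 p. 63] -/
theorem tailsClaim_of_gtilde1_eq
    (h : ∀ (D : ℕ) (y : ℝ), gtilde1 D y =
      -500 * (∫ z in (0.5 : ℝ)..0.502, gW D (bigP D ^ z / y)) +
        500 * (∫ z in (0.502 : ℝ)..0.504, gW D (bigP D ^ z / y))) :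
    TailsClaim := by
  obtain ⟨c, hc, C, D₀, hD₀⟩ := tails_bound
  refine ⟨c, hc, C, D₀, fun D _ χ hD hq hp hA x s hs => ?_⟩
  simp only [h]
  exact hD₀ D χ hD hq hp hA x s hs

/-- **`Z22:§11.u005b` holds in its v1 typing too** (`Typed.Sec11A.TailsClaim`, over the banked
`Skeleton.gtilde1`): after the skeleton's in-place re-parenthesisation of `g̃₁` (landed revision of
`SkeletonPartTwo`, 2026-08-26), `Skeleton.gtilde1 D y` unfolds by `rfl` to the printed
`−500∫_{0.5}^{0.502} g(P^z/y)dz + 500∫_{0.502}^{0.504} g(P^z/y)dz`, so the bridge applies.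
[Z22 p.63, tex L3216] [cite: Zhang2022LandauSiegel, §11 p. 63] -/
theorem tailsClaim_holds : TailsClaim := tailsClaim_of_gtilde1_eq fun _ _ => rfl

end Literature.NumberTheory.LFunctions.Zhang2022.Typed.Sec11A
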